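import Literature.Computability.MetaComplexity.PromiseRandReductions
import Literature.Computability.Complexity.PromiseBPPAmplification
import Literature.Computability.Complexity.PromiseBPPClosureProofs
import Literature.Computability.Complexity.BPPErrorReductionStrong
import Literature.Computability.Complexity.MajorityVote
import HarnessLib

/-!
# Stub `stub_randClosure` of line `orbit-pair-rsr` for crux `SzkEntropy.PeaWorstToAvg`
(item stmt-PneNP-10777, route route-PneNP-SzkEntropy)

**Textbook promise-BPP is closed downwards under randomized Karp reductions of promise problems**
(Arora–Barak 2009, §7.6 / Def. 7.16 with Def. 7.3; Goldreich 2006, §1.2, Def. 2–3 and the remark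
after Def. 3): if `PromiseRandReducible Q₁ Q₂` (a PPT `A` with exact polynomial coin budget `q`,
`x ∈ Q₁.yes → Pr_r[A(x;r) ∈ Q₂.yes] ≥ 2/3`, `x ∈ Q₁.no → Pr_r[A(x;r) ∈ Q₂.no] ≥ 2/3`) and
`Q₂ ∈ PromiseBPP'`, then `Q₁ ∈ PromiseBPP'` (`mem_PromiseBPP'_of_promiseRandReducible`; the
registered stub `stub_randClosure` is its explicit-binder alias).

## Proof

1. *Pull back and amplify.* The run map `g = uncurry A.run ∘ boolUnpair ∈ FP` Karp-reduces the
   promise problem `Q' = (g⁻¹ Q₂.yes, g⁻¹ Q₂.no)` on PAIRS `⟨x, r⟩` to `Q₂`, so `Q' ∈ PromiseBPP'`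
   by the deterministic closure `PromiseProblem.mem_PromiseBPP'_of_polyTimeReducible_holds`
   (Goldreich 2006), and `PromiseProblem.exists_amplifier_of_mem_PromiseBPP'` gives a witness
   `L'' ∈ P` with coins `p''` and two-sided error `≤ 1/12` on the promise of `Q'`.
2. *One trial.* On `x` with a coin block `z = r s`, `|r| = q(|x|)`, `|s| = p''(|⟨x, r⟩|)`,
   accept iff `⟨⟨x, r⟩, s⟩ ∈ L''`; as a language,
   `T = (pairFn (truncSndFn q) (sndP ∘ dropSndFn q))⁻¹ L'' ∈ P`.
   For `x ∈ Q₁.yes` the trial accepts with probability `≥ 2/3 - 1/12 = 7/12`: it fails only if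
   `A(x; r) ∉ Q₂.yes` (probability `≤ 1/3`) or `⟨x, r⟩ ∈ Q'.yes` and the fresh coins `s` err
   (probability `≤ 1/12`, `uniformProb_block_le`); symmetrically it rejects with probability
   `≥ 7/12` for `x ∈ Q₁.no` (`uniformProb_seq_ge`). Nothing is used off the promise of `Q₂`.
3. *Majority of `108` trials.* The witness for `Q₁` is the majority-vote language
   `BPPAmp.majLang T B (C 108) ∈ P` (`BPPErrorReductionStrong.lean`) over `108` blocks of
   `B = q + p'' ∘ (2X + 2 + q)` coins; by Chebyshev (`card_majority_fail_le`, `η = 1/12`,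
   `δ = 1/3`, `108 = 1/(4δη²)` trials) a wrong majority has probability `≤ 1/3`
   (`uniformProb_majority_fail_le`).

References: S. Arora, B. Barak, *Computational Complexity: A Modern Approach* (2009), Def. 7.3,
§7.4.1 (Thm. 7.10), §7.6 (Def. 7.16) [AroraBarak2009]; O. Goldreich, *On promise problems: a
survey*, LNCS 3895 (2006), §1.2 [Goldreich2006]; M. Blum, S. Micali, SIAM J. Comput. 13 (1984),
§3.3 (majority by the weak law) [BlumMicali1984].
-/

namespace Summit.PneNP.PneNP.Cruxes.PeaWorstToAvg.OrbitPairRsr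

set_option linter.dupNamespace false -- Summit.PneNP.PneNP: summit = sub-problem (D-0017)

open Literature.Computability.Complexity Literature.Computability.MetaComplexity
open _root_.Computability Polynomial Finset

namespace RandClosure

/-! ### Counting lemmas -/

/-- Monotonicity of `uniformProb m` along an implication on the strings of length `m`. [folklore] -/
theorem uniformProb_mono_of_imp {m : ℕ} {E F : Set (List Bool)}
    (h : ∀ z : List Bool, z.length = m → z ∈ E → z ∈ F) : uniformProb m E ≤ uniformProb m F := by
  classical
  unfold uniformProb
  refine div_le_div_of_nonneg_right ?_ (by positivity)
  exact_mod_cast card_le_card fun r hr => by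
    simp only [mem_filter, mem_univ, true_and] at hr ⊢
    exact h _ (List.Vector.toList_length r) hr

/-- **Two-stage sampling, lower bound.** On coin strings `z = Y v` of length `a + k`: if the first
stage `Y ∈ {0,1}^a` is good with probability `≥ α`, and after every good `Y` the second stage
`v ∈ {0,1}^k` fails the test `D Y` with probability `≤ β`, then `D (z↾a) (z⇂a)` holds with
probability `≥ α - β` (union bound over the two failure modes; the second uses fresh coins,
`uniformProb_block_le`). [cite: AroraBarak2009, §7.4.1 and §A.2] -/
theorem uniformProb_seq_ge {a k : ℕ} (G : Set (List Bool)) (D : List Bool → List Bool → Prop)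
    {α β : ℝ} (hβ : 0 ≤ β) (hG : α ≤ uniformProb a G)
    (hD : ∀ Y : List Bool, Y.length = a → Y ∈ G → uniformProb k {v | ¬ D Y v} ≤ β) :
    α - β ≤ uniformProb (a + k) {z | D (z.take a) (z.drop a)} := by
  classical
  -- failure of the first stage
  have h1 : uniformProb (a + k) {z | z.take a ∈ Gᶜ} ≤ 1 - α := by
    rw [uniformProb_take_of_le (Nat.le_add_right a k), uniformProb_compl]
    linarith
  -- failure of the second stage after a good first stage (fresh coins)
  set Bad : List Bool → Set (List Bool) := fun w => if w ∈ G then {v | ¬ D w v} else ∅ with hBad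
  have h2 : uniformProb (a + k) {z | (z.drop a).take k ∈ Bad (z.take a)} ≤ β := by
    have hBadβ : ∀ w : List Bool, w.length = a → uniformProb k (Bad w) ≤ β := by
      intro w hw
      simp only [hBad]
      split_ifs with hwG
      · exact hD w hw hwG
      · rw [uniformProb_empty]
        exact hβ
    have h := uniformProb_block_le (a := a) (ℓ := k) (d := 0) Bad hBadβ
    rw [Nat.add_zero] at h
    exact h
  -- the failure event is covered by the two
  have h3 : uniformProb (a + k) {z | ¬ D (z.take a) (z.drop a)} ≤ (1 - α) + β := by
    refine (uniformProb_mono_of_imp fun z hz hfail => ?_).trans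
      ((uniformProb_union_le _ _ _).trans (add_le_add h1 h2))
    by_cases hzG : z.take a ∈ G
    · refine Set.mem_union_right _ ?_
      show (z.drop a).take k ∈ Bad (z.take a)
      have htk : (z.drop a).take k = z.drop a := List.take_of_length_le (by simp [hz])
      rw [hBad]
      dsimp only
      rw [if_pos hzG, htk]
      exact hfail
    · exact Set.mem_union_left _ hzG
  have h4 := uniformProb_compl (a + k) {z | D (z.take a) (z.drop a)}
  rw [Set.compl_setOf] at h4
  linarith

/-- The accepted-run count of `BPPAmp.count` is the number of blocks in the acceptance event.
[folklore] -/
theorem count_eq_nbad (L' : Language Bool) (p T : Polynomial ℕ) (x y : List Bool) :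
    BPPAmp.count L' p T x y =
      BPPAmp.nbad (T.eval x.length) (p.eval x.length) {z | boolPair x z ∈ L'} y := by
  unfold BPPAmp.count BPPAmp.nbad
  refine sum_congr rfl fun j _ => ?_
  by_cases hj : boolPair x (BPPAmp.block (p.eval x.length) j y) ∈ L'
  · rw [(Set.mem_iff_boolIndicator _ _).1 hj,
      if_pos (show BPPAmp.block (p.eval x.length) j y ∈ {z | boolPair x z ∈ L'} from hj)]
    rfl
  · rw [(Set.notMem_iff_boolIndicator _ _).1 hj,
      if_neg (show ¬ BPPAmp.block (p.eval x.length) j y ∈ {z | boolPair x z ∈ L'} from hj)]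
    rfl

/-- Blocks in an event and blocks outside it together are all `t` blocks. [folklore] -/
theorem nbad_add_nbad_not (t P : ℕ) (G : Set (List Bool)) (y : List Bool) :
    BPPAmp.nbad t P G y + BPPAmp.nbad t P {z | z ∉ G} y = t := by
  unfold BPPAmp.nbad
  rw [← sum_add_distrib]
  calc _ = ∑ _j ∈ range t, 1 := sum_congr rfl fun j _ => by
          by_cases h : BPPAmp.block P j y ∈ G
          · rw [if_pos h, if_neg (fun h' : BPPAmp.block P j y ∈ {z | z ∉ G} => h' h)]
          · rw [if_neg h, if_pos (show BPPAmp.block P j y ∈ {z | z ∉ G} from h)]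
    _ = t := by rw [sum_const, card_range, smul_eq_mul, mul_one]

/-- **Majority of `t ≥ 108` blocks, each good with probability `≥ 7/12 = 1/2 + 1/12`**: the
strings of `t` blocks without a strict majority of good blocks have probability `≤ 1/3`
(Chebyshev, `card_majority_fail_le` with `η = 1/12`, `δ = 1/3`, `1/(4δη²) = 108`, read on coin
strings through `BPPAmp.blocksEquiv`). [cite: BlumMicali1984, §3.3 Lemma 2] -/
theorem uniformProb_majority_fail_le {t P : ℕ} (G : Set (List Bool))
    (hG : (7 / 12 : ℝ) ≤ uniformProb P G) (ht : 108 ≤ t) :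
    uniformProb (t * P) {y | 2 * BPPAmp.nbad t P G y ≤ t} ≤ 1 / 3 := by
  classical
  rw [uniformProb_eq_cnt_div, div_le_iff₀ (by positivity)]
  -- transfer to the product space
  have htrans : cnt (t * P) {y | 2 * BPPAmp.nbad t P G y ≤ t} =
      (univ.filter fun ω : Fin t → Fin P → Bool =>
        2 * (univ.filter fun j : Fin t => List.ofFn (ω j) ∈ G).card ≤ t).card := by
    unfold cnt
    refine card_equiv (BPPAmp.blocksEquiv t P) fun v => ?_
    simp only [mem_filter, mem_univ, true_and, Set.mem_setOf_eq]
    rw [BPPAmp.nbad_eq_card]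
  -- the good fraction of one block, in counting form
  have hgood : (1 / 2 + 1 / 12 : ℝ) * Fintype.card (Fin P → Bool) ≤
      (univ.filter fun v : Fin P → Bool => List.ofFn v ∈ G).card := by
    rw [uniformProb_eq_card_fun, le_div_iff₀ (by positivity)] at hG
    rw [card_fun_fin_bool]
    push_cast
    linarith
  have ht' : 1 / (4 * (1 / 3 : ℝ) * (1 / 12) ^ 2) ≤ (t : ℝ) := by
    norm_num
    exact_mod_cast ht
  have hmaj := card_majority_fail_le (α := Fin P → Bool) (fun v => List.ofFn v ∈ G)
    (m := t) (η := 1 / 12) (δ := 1 / 3) (by norm_num) (by norm_num) ht' hgood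
  rw [Fintype.card_fun, Fintype.card_fin, card_fun_fin_bool, ← pow_mul, mul_comm P t,
    ← htrans] at hmaj
  push_cast at hmaj
  exact hmaj

end RandClosure

open RandClosure

/-! ### The closure theorem -/

/-- **Promise-BPP is closed downwards under randomized Karp reductions** (Arora–Barak 2009, §7.6
with Def. 7.16 / Def. 7.3; Goldreich 2006, §1.2: "the standard meaning of a reduction is
preserved"): if `PromiseRandReducible Q₁ Q₂` and `Q₂ ∈ PromiseBPP'` then `Q₁ ∈ PromiseBPP'`.
Proof: pull the amplified decider of `Q₂` back along the run map of the reduction (one trial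
succeeds with probability `≥ 7/12` on the promise of `Q₁`) and take the majority of `108`
independent trials. [cite: AroraBarak2009, §7.6 (Def. 7.16) and §7.4.1] -/
theorem mem_PromiseBPP'_of_promiseRandReducible {Q₁ Q₂ : PromiseProblem}
    (h₁₂ : PromiseRandReducible Q₁ Q₂) (h₂ : Q₂ ∈ PromiseBPP') : Q₁ ∈ PromiseBPP' := by
  classical
  obtain ⟨A, hA, ⟨q, hq⟩, hAy, hAn⟩ := h₁₂
  -- Step 1: the run map as a total string function and the pulled-back promise problem on pairs
  set g : List Bool → List Bool := Function.uncurry A.run ∘ boolUnpair with hg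
  have hgFP : g ∈ FP := PolyTimeComputable.comp_holds hA.1 polyTimeComputable_boolUnpair
  have hg_pair : ∀ x r : List Bool, g (boolPair x r) = A.run x r := fun x r => by
    simp [hg]
  set Q' : PromiseProblem := ⟨g ⁻¹' Q₂.yes, g ⁻¹' Q₂.no⟩ with hQ'def
  have hQ' : Q' ∈ PromiseBPP' :=
    PromiseProblem.mem_PromiseBPP'_of_polyTimeReducible_holds'
      ⟨g, hgFP, fun _ hw => hw, fun _ hw => hw⟩ h₂
  -- Step 2: amplify the decider of `Q'` to error `≤ 1/12` on its promise
  obtain ⟨L'', hL'', p'', hyes, hno, -⟩ :=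
    PromiseProblem.exists_amplifier_of_mem_PromiseBPP' hQ' (C 11)
  have h12 : ∀ w : List Bool,
      (1 : ℝ) / (((C 11 : Polynomial ℕ).eval w.length : ℕ) + 1) = 1 / 12 := by
    intro w
    rw [eval_C]
    norm_num
  -- Step 3: one trial `⟨x, z⟩ ↦ [⟨⟨x, z↾q|x|⟩, z⇂q|x|⟩ ∈ L'']`
  set T : Language Bool := (pairFn (truncSndFn q) (sndP ∘ dropSndFn q)) ⁻¹' L'' with hTdef
  have hT : T ∈ Classes.P :=
    preimage_mem_P hL''
      (pairFn_mem_FP (truncSndFn_mem_FP q) (comp_mem_FP sndP_mem_FP (dropSndFn_mem_FP q)))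
  have hmemT : ∀ x z : List Bool, boolPair x z ∈ T ↔
      boolPair (boolPair x (z.take (q.eval x.length))) (z.drop (q.eval x.length)) ∈ L'' := by
    intro x z
    show pairFn (truncSndFn q) (sndP ∘ dropSndFn q) (boolPair x z) ∈ L'' ↔ _
    rw [pairFn_apply, truncSndFn_boolPair, Function.comp_apply, dropSndFn_boolPair, sndP_boolPair]
  -- the block length `B(n) = q(n) + p''(2n + 2 + q(n))`
  set B : Polynomial ℕ := q + p''.comp (C 2 * X + C 2 + q) with hBdef
  have hB : ∀ n, B.eval n = q.eval n + p''.eval (2 * n + 2 + q.eval n) := by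
    intro n
    simp only [hBdef, eval_add, eval_comp, eval_mul, eval_C, eval_X]
  -- the reduction's success probabilities in counting form
  have hpr : ∀ (x : List Bool) (E : Set (List Bool)),
      A.pr id x E = uniformProb (q.eval x.length) {Y | A.run x Y ∈ E} := by
    intro x E
    rw [RandAlg.pr_eq_uniformProb]
    change uniformProb (A.coinLen x.length) _ = _
    rw [hq]
  -- trial, YES side
  have htrial_yes : ∀ x ∈ Q₁.yes,
      (7 / 12 : ℝ) ≤ uniformProb (B.eval x.length) {z | boolPair x z ∈ T} := by
    intro x hx
    have hset : {z | boolPair x z ∈ T} =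
        {z | boolPair (boolPair x (z.take (q.eval x.length))) (z.drop (q.eval x.length)) ∈ L''} :=
      Set.ext fun z => hmemT x z
    rw [hset, hB]
    have hG : (2 / 3 : ℝ) ≤ uniformProb (q.eval x.length) {Y | A.run x Y ∈ Q₂.yes} := by
      have h := hAy x hx
      rw [hpr] at h
      exact h
    have hD : ∀ Y : List Bool, Y.length = q.eval x.length → Y ∈ {Y | A.run x Y ∈ Q₂.yes} →
        uniformProb (p''.eval (2 * x.length + 2 + q.eval x.length))
          {v | ¬ boolPair (boolPair x Y) v ∈ L''} ≤ 1 / 12 := by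
      intro Y hY hYG
      have hw : boolPair x Y ∈ Q'.yes := by
        show g (boolPair x Y) ∈ Q₂.yes
        rw [hg_pair]; exact hYG
      have h := hyes (boolPair x Y) hw
      rw [h12, length_boolPair, hY] at h
      exact h
    have h := uniformProb_seq_ge {Y | A.run x Y ∈ Q₂.yes}
      (fun Y v => boolPair (boolPair x Y) v ∈ L'') (by norm_num) hG hD
    calc (7 / 12 : ℝ) = 2 / 3 - 1 / 12 := by norm_num
      _ ≤ _ := h
  -- trial, NO side
  have htrial_no : ∀ x ∈ Q₁.no,
      (7 / 12 : ℝ) ≤ uniformProb (B.eval x.length) {z | boolPair x z ∉ T} := by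
    intro x hx
    have hset : {z | boolPair x z ∉ T} =
        {z | boolPair (boolPair x (z.take (q.eval x.length))) (z.drop (q.eval x.length)) ∉ L''} :=
      Set.ext fun z => (hmemT x z).not
    rw [hset, hB]
    have hG : (2 / 3 : ℝ) ≤ uniformProb (q.eval x.length) {Y | A.run x Y ∈ Q₂.no} := by
      have h := hAn x hx
      rw [hpr] at h
      exact h
    have hD : ∀ Y : List Bool, Y.length = q.eval x.length → Y ∈ {Y | A.run x Y ∈ Q₂.no} →
        uniformProb (p''.eval (2 * x.length + 2 + q.eval x.length))
          {v | ¬ boolPair (boolPair x Y) v ∉ L''} ≤ 1 / 12 := by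
      intro Y hY hYG
      have hw : boolPair x Y ∈ Q'.no := by
        show g (boolPair x Y) ∈ Q₂.no
        rw [hg_pair]; exact hYG
      have h := hno (boolPair x Y) hw
      rw [h12, length_boolPair, hY] at h
      simp only [not_not]
      exact h
    have h := uniformProb_seq_ge {Y | A.run x Y ∈ Q₂.no}
      (fun Y v => boolPair (boolPair x Y) v ∉ L'') (by norm_num) hG hD
    calc (7 / 12 : ℝ) = 2 / 3 - 1 / 12 := by norm_num
      _ ≤ _ := h
  -- Step 4: the majority of `108` trials
  refine ⟨BPPAmp.majLang T B (C 108), BPPAmp.majLang_mem_P B (C 108) hT, C 108 * B,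
    fun x hx => ?_, fun x hx => ?_⟩
  · -- YES: a non-majority of accepting blocks has probability `≤ 1/3`
    rw [eval_mul, eval_C]
    have hfail : uniformProb (108 * B.eval x.length)
        {y | boolPair x y ∉ BPPAmp.majLang T B (C 108)} ≤ 1 / 3 := by
      refine (uniformProb_mono_of_imp fun y _ hy => ?_).trans
        (uniformProb_majority_fail_le {z | boolPair x z ∈ T} (htrial_yes x hx) le_rfl)
      have hy' : ¬ ((C 108 : Polynomial ℕ).eval x.length < 2 * BPPAmp.count T B (C 108) x y) := by
        rw [← BPPAmp.boolPair_mem_majLang]; exact hy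
      rw [count_eq_nbad, eval_C] at hy'
      show 2 * BPPAmp.nbad 108 (B.eval x.length) {z | boolPair x z ∈ T} y ≤ 108
      omega
    have hc := uniformProb_compl (108 * B.eval x.length)
      {y | boolPair x y ∈ BPPAmp.majLang T B (C 108)}
    rw [Set.compl_setOf] at hc
    linarith
  · -- NO: a majority of accepting blocks has probability `≤ 1/3`
    rw [eval_mul, eval_C]
    have hfail : uniformProb (108 * B.eval x.length)
        {y | boolPair x y ∈ BPPAmp.majLang T B (C 108)} ≤ 1 / 3 := by
      refine (uniformProb_mono_of_imp fun y _ hy => ?_).trans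
        (uniformProb_majority_fail_le {z | boolPair x z ∉ T} (htrial_no x hx) le_rfl)
      have hy' : (C 108 : Polynomial ℕ).eval x.length < 2 * BPPAmp.count T B (C 108) x y := by
        rw [← BPPAmp.boolPair_mem_majLang]; exact hy
      rw [count_eq_nbad, eval_C] at hy'
      have hsum := nbad_add_nbad_not 108 (B.eval x.length) {z | boolPair x z ∈ T} y
      show 2 * BPPAmp.nbad 108 (B.eval x.length) {z | boolPair x z ∉ T} y ≤ 108
      change BPPAmp.nbad 108 (B.eval x.length) {z | boolPair x z ∈ T} y +
        BPPAmp.nbad 108 (B.eval x.length) {z | boolPair x z ∉ T} y = 108 at hsum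
      omega
    have hc := uniformProb_compl (108 * B.eval x.length)
      {y | boolPair x y ∈ BPPAmp.majLang T B (C 108)}
    rw [Set.compl_setOf] at hc
    linarith

/-- **Registered stub `stub_randClosure`** of the line `orbit-pair-rsr` (crux stmt-PneNP-10777):
textbook promise-BPP is closed under randomized Karp reductions — the explicit-binder alias of
`mem_PromiseBPP'_of_promiseRandReducible`. [cite: AroraBarak2009, §7.6 (Def. 7.16)] -/
theorem stub_randClosure (Q₁ Q₂ : PromiseProblem) (h₁₂ : PromiseRandReducible Q₁ Q₂)
    (h₂ : Q₂ ∈ PromiseBPP') : Q₁ ∈ PromiseBPP' :=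
  mem_PromiseBPP'_of_promiseRandReducible h₁₂ h₂

end Summit.PneNP.PneNP.Cruxes.PeaWorstToAvg.OrbitPairRsr
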